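import Literature.MathematicalPhysics.QuantumFieldTheory.Balaban1983to89.B8Eq155JBound
import Literature.MathematicalPhysics.QuantumFieldTheory.Balaban1983to89.B15PrelimIntegrations
import Literature.MathematicalPhysics.QuantumFieldTheory.Balaban1983to89.B14

/-!
# `Balaban1983to89.B15Ineq146Proof` — T. Bałaban, *Large field renormalization. I. The basic step of the 𝐑
# operation*, Commun. Math. Phys. **122** (1989) 175–202 [Balaban1989LargeFieldI], (1.46) p. 186: the plaquette
# perturbation estimate behind *"Using the representation (1.44), and the above estimate, we obtain (1.46)"* —
# FIRST printed inequality PROVED on the `ℤ^d` lattice carriers, and the typed leaf of the second inequality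
# (`B15.PrelimIntegrations.Ineq146`, reader r12) DISCHARGED from (1.45) and [III] (2.8)

statement-level skeleton of published theorems with citation tags; proofs where landed; nothing here is a claim
about the Yang–Mills mass gap

PDF held: `paper:balaban1989-cmp122-large-field-i` (journal page = PDF page + 174); p. 186 [PDF 12] READ AS AN
IMAGE on the x2 render `run/shared/lean/pub/pub-balaban/b2b-balaban-ref1/pages/1989-cmp122-large-field-I/…-p012-x2.png`
(the OCR layer of this page is unusable).  "[III]" = [Balaban1988Convergent] (CMP **119**), (2.8) p. 256 (tree:
`B14.FlowIneq28`); "[12]" = [Balaban1985Averaging] (24) p. 21; "[14]" = [Balaban1985RegularSpaces] (1.21)/(1.22)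
p. 79, (1.47) p. 84 (tree: `B8Eq143PlaqExpansion`, `B8Eq146AExpansion`); (3.4) of [Balaban1985BackgroundPropagators]
p. 391 (the plaquette covariant derivative, tree `B8Eq146AExpansion.plaqCovDeriv`).

WHAT IS REPRODUCED.  SKELETON row **B15.Eq1.46** (mega-formalization `lit-balaban`, HOME
`run/shared/lean/pub/lit-balaban/`, Phase-2 proof seat `p29` gen 6, unit `lit-balaban-p29`; rows of record
`lit-balaban-r12/ROWS-B15.md`, where (1.46) was `typed p239014 · second inequality` only).  THE PRINTED TEXT (p. 186,
verbatim from the render): *"the configuration U^{(n)}_{k,Z}. Representing the field V_j on Ω^c_{j+1}∖Z″_{j+1} as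
[V_j(V^{(j)}_Z)⁻¹]V^{(j)}_Z, we have  U^{(n)}_{k,Z} = (exp iηℍ^{(n)}_{k,Z}((1/i) log[V_j(V^{(j)}_Z)⁻¹]) U^{(n+1)}_{k,Z})^{u⁻¹}.
(1.44)  The field in the argument of the function ℍ^{(n)}_k is bounded by 4δ′_j, and is localized in the domain
Ω^c_{j+1}∖Z″_{j+1}, therefore the following estimate holds:  sup_{B^i(y)} L^iη|ℍ^{(n)}_{k,Z}|,
sup_{B^i(y)} (L^iη)²|∇^η_{U^{(n+1)}_k}ℍ^{(n)}_{k,Z}| ≦ B₃exp(−δd(y, Ω^c_{j+1}∖Z″_{j+1}))4δ′_j. (1.45)  Here d(·,·) is the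
scaled distance, y is a point of the i-th component of the determining set 𝔹_k^{(n)}. Using the representation
(1.44), and the above estimate, we obtain
|U^{(n)}_{k,Z}(∂p) − 1| ≦ |U^{(n+1)}_{k,Z}(∂p) − 1|(1 + ½η|ℍ^{(n)}_{k,Z}|(∂p)) + η²|(D^η_{U^{(n+1)}_{k,Z}}ℍ^{(n)}_{k,Z})(p)|
+ ½η²(|ℍ^{(n)}_{k,Z}|(∂p))²  ≦ |U^{(n+1)}_{k,Z}(∂p) − 1|(1 + 8B₃L^{−i}exp(−δd(y, Ω^c_{j+1}∖Z″_{j+1}))δ′_j)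
+ 9B₃(A₁p₁(g_j))/(A₀p₀(g_j))(1 + β₀)(1 + (j − i)^{1/2})exp(−δd(y, Ω^c_{j+1}∖Z″_{j+1}))ε_i(L^{k−i}η)²  for p∈B^i(y),
where y∈(Z″_{i+1}∖Z″_i)^{(i)} = Γ″_i for i = j − 1, j − 2, …, and y∈(Ω^c_{j+1}∖Z″_j)^{(j)} for i = j. (1.46)"*; and, same
page: *"The numerical factor 8B₃L^{−i}δ′_j < 8B₃γA₁p₁(γ) can be also chosen arbitrarily small for γ sufficiently
small."*; p. 183 l. 1: *"δ′_j = g_jA₁p₁(g_j)"*; [III] (2.4) p. 255: `ε_j = g_jA₀p₀(g_j)`; [III] (2.8) p. 256: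
*"ε_n ≤ (1+β₀)(n−m)^{1/2} ε_m"* (n > m).

THE ARGUMENT FORMALISED (print gives none beyond "Using the representation (1.44), and the above estimate").
Write `U₀ = U^{(n+1)}`, `U′ = e^{iηH}` bondwise (`H = ℍ^{(n)}_{k,Z}(…)` a 𝔤-valued bond field), `U = (U′U₀)^{g}`, `g = u⁻¹`.
For a plaquette `p = p_{μν}(x) = ⟨x, y, z, w⟩`:  (i) the gauge transformation conjugates `U(∂p)` by the unitary
`g(x)`, so `|U(∂p) − 1| = |(U′U₀)(∂p) − 1|` ((8) of [12]; tree `B8Ineq132.plaqF_gaugeAct`);  (ii) by (1.21) of [14]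
(tree `B8Eq143PlaqExpansion.eq121`) `(U′U₀)(∂p) = a·U₀(∂p)·c` with the unitary words `a = U′(x,y)R(U₀(x,y))U′(y,z)`,
`c = R(U₀(x,w))U′(z,w)U′(w,x)`, and `ac = (∂_{U₀}U′)(p) = e^{x₁}e^{x₂}e^{x₃}e^{x₄}` ((1.22)/(1.47) of [14], tree
`covPlaqF_expCfg`) with `x₁ + x₂ + x₃ + x₄ = iη²(D^η_{U₀}H)(p)` ((3.4), tree `lin_printed`) and `Σ|xᵢ| = η Σ_{b⊂∂p}|H(b)|`
(`bdry_iEta`);  (iii) `aPc − 1 = a(P − 1)c + (ac − 1)`, `|a(P − 1)c| ≤ |P − 1|`;  (iv) THE SHARP UNITARY TAYLOR BOUND: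
for skew-adjoint `xᵢ` (here `iη·hermitian`, conjugated by unitaries) `|e^{x} − 1| ≤ |x|` ((24) of [12]) and
`|e^{x} − 1 − x| ≤ ½|x|²` (fencing lemma along `s ↦ e^{sx}`), and these two bounds are multiplicative with amplitudes
adding (`|P₁P₂ − 1 − L₁ − L₂| ≤ |P₁ − 1 − L₁| + |P₂ − 1 − L₂| + |P₁ − 1||P₂ − 1|`), whence
`|e^{x₁}e^{x₂}e^{x₃}e^{x₄} − 1 − Σxᵢ| ≤ ½(Σ|xᵢ|)²`.  Together:
  `|U(∂p) − 1| ≤ |U₀(∂p) − 1| + η²|(D^η_{U₀}H)(p)| + ½η²(Σ_{b⊂∂p}|H(b)|)²`      (`mechanism`, `mechanism_iEta`)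
which implies the FIRST printed inequality of (1.46) (`ineq146_first`; the printed extra term
`|U₀(∂p) − 1|·½η|H|(∂p) ≥ 0` is not even needed).  (v) The SECOND inequality: with `X := B₃e^{−δd}4δ′_j`, (1.45) at
the four bonds of `∂p ⊂ B^i(y)` gives `η|H(b)| ≤ L^{−i}X`, hence `½η|H|(∂p) ≤ 2L^{−i}X = 8B₃L^{−i}e^{−δd}δ′_j` (print's
factor exactly), and at the two covariant derivatives entering `(D^η_{U₀}H)(p_{μν}(x)) = (D_μH_ν − D_νH_μ)(x)` gives
`η²|(DH)(p)| ≤ 2L^{−2i}X`; `½η²(|H|(∂p))² ≤ 8L^{−2i}X²`; so the last two terms are `≤ 2L^{−2i}X(1 + 4X) ≤ (9/4)L^{−2i}X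
= 9B₃e^{−δd}δ′_jL^{−2i}` as soon as `4X ≤ 1/8`, i.e. under the located smallness `128B₃δ′_j ≤ 1` (print: "8B₃L^{−i}δ′_j
… can be also chosen arbitrarily small"); finally `δ′_j = (A₁p₁(g_j))/(A₀p₀(g_j))·ε_j` (p. 183 with [III] (2.4)) and
`ε_j ≤ (1+β₀)(1 + (j−i)^{1/2})ε_i` ([III] (2.8) for `i < j`, `β₀ ≥ 0` for `i = j`; `flowFactor_of_flowIneq28`), and
`L^{−2i}ε_i = ε_i(L^{k−i}η)²` for `η = L^{−k}` (`units_εE`) — which is r12's typed leaf `Ineq146` VERBATIM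
(`ineq146_of_145`, `ineq146_holds_lattice`).

MODEL / DECLARED DEVIATIONS (referee columns F6/F7).  (M1) LATTICE: `T_η` is read on `ℤ^d` (sites `Fin d → ℤ`, the
`B7Prop1Explicit`/`B8Ineq132` dictionary: `U(x, κ) = U(⟨ηx, η(x+e_κ)⟩)`, plaquette variable `B8Ineq132.plaqF`,
covariant derivatives with the explicit `η`); the group `G` = the unitaries of a unital C⋆-algebra `𝔸` (`U(N)`,
`SU(N) ⊂ M_N(ℂ)`), `𝔤` = its self-adjoint part (Bałaban's `U = e^{iA}`, `A` hermitian), `|·|` = the C⋆ (operator)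
norm; the background `U₀ = U^{(n+1)}` and the gauge transformation need only lie in `{|u| ≤ 1, |u⁻¹| ≤ 1}`
(`B7Prop1Explicit.U1`).  (M2) `ℍ^{(n)}_{k,Z}(…)` enters as an ARBITRARY self-adjoint bond field `H` — its analytic
origin ((1.44), [III] (3.27)) is not used by the estimate; (1.45) enters through r12's leaf `Ineq145 sH sDH …` with
the two printed sups INSTANTIATED where the estimate uses them: at the four bonds of `∂p` and at the two covariant
derivatives `(∇^η_{U₀,μ}H_ν)(x)`, `(∇^η_{U₀,ν}H_μ)(x)` ("for p ∈ B^i(y)": these bonds/sites lie in `B^i(y)`, over which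
print's sups run).  (M3) `|ℍ|(∂p)` is read as `Σ_{b⊂∂p}|H(b)|` (the reading under which print's own step
`½η|ℍ|(∂p) ≤ 8B₃L^{−i}e^{−δd}δ′_j` from (1.45) is an identity of constants).  (M4) SMALLNESS made explicit:
`128B₃δ′_j ≤ 1` (located; print's "arbitrarily small"), signs `B₃, δ′_j, (A₁p₁)/(A₀p₀), ε_i, β₀ ≥ 0`, `δd ≥ 0`,
`η > 0`, `L^{−i} ≥ 0`.  (M5) Strict `<` nowhere: (1.46) is printed with `≦`.  Net new unproved facts: 0 (theorems
only; no `def`).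
-/

open scoped BigOperators
open NormedSpace Finset Complex

namespace Literature.MathematicalPhysics.QuantumFieldTheory.Balaban1983to89.B15Ineq146Proof

open B7Prop1Explicit
open B7Eq78Linearization (conjR conjR_apply conjR_one conjR_add conjR_sub conjR_smul)
open B8Lemma1NonAbelian (mulCfg)
open B8Ineq132 (plaqF covDerivFwd plaqF_gaugeAct norm_conjR norm_conjR_le)
open B8Eq143PlaqExpansion (lead trail covPlaq covPlaqF eq121 lead_mem trail_mem)
open B8Eq146AExpansion (X1 X2 X3 X4 lin bdry plaqCovDeriv expCfg iEta covPlaqF_expCfg exp_conjR conjR_neg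
  lin_printed bdry_iEta plaqCovDeriv_eq_covDerivFwd)
open B15.PrelimIntegrations (Ineq145 Ineq146)

-- `Site` alone could resolve to the torus sites of `Setup.lean` through a parent namespace; re-export the `ℤ^d`
-- sites of `B7Prop1Explicit`.
export B7Prop1Explicit (Site)

variable {d : ℕ}

/-! ## §1 The sharp Taylor bounds for unitary exponentials in a C⋆-algebra ((24) of [12] and its second order) -/

section CStar

variable {𝔸 : Type*} [CStarAlgebra 𝔸]

/-- A skew-adjoint `X` is `i·Y` with `Y = −iX` hermitian (Bałaban's `log U = iA`, (22)–(23) of [12]). [folklore] -/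
private theorem isSelfAdjoint_negI_smul {X : 𝔸} (hX : X ∈ skewAdjoint 𝔸) :
    IsSelfAdjoint ((-I) • X) ∧ I • ((-I) • X) = X := by
  refine ⟨?_, ?_⟩
  · rw [IsSelfAdjoint, star_smul, star_neg, Complex.star_def, Complex.conj_I, neg_neg,
      skewAdjoint.mem_iff.mp hX, smul_neg, neg_smul]
  · rw [smul_smul, mul_neg, Complex.I_mul_I, neg_neg, one_smul]

/-- Real multiples of skew-adjoint elements are skew-adjoint. [folklore] -/
private theorem ofReal_smul_mem_skewAdjoint {X : 𝔸} (hX : X ∈ skewAdjoint 𝔸) (s : ℝ) : (s : ℂ) • X ∈ skewAdjoint 𝔸 := by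
  rw [skewAdjoint.mem_iff, star_smul, Complex.star_def, Complex.conj_ofReal, skewAdjoint.mem_iff.mp hX, smul_neg]

/-- `iηH(b)` is skew-adjoint for hermitian `H(b)` and real `η`. [cite: Balaban1985Averaging, (22)–(23) p.21] -/
theorem I_eta_smul_mem_skewAdjoint (η : ℝ) {Y : 𝔸} (hY : IsSelfAdjoint Y) : ((I : ℂ) * η) • Y ∈ skewAdjoint 𝔸 := by
  rw [B8Eq155JBound.I_eta_smul_eq]
  exact (B8Eq155JBound.isSelfAdjoint_real_smul η hY).smul_mem_skewAdjoint Complex.conj_I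

/-- `e^X` is unitary for skew-adjoint `X`. [folklore] -/
private theorem exp_mem_unitary_of_skew {X : 𝔸} (hX : X ∈ skewAdjoint 𝔸) : exp X ∈ unitary 𝔸 := by
  obtain ⟨hY, hXY⟩ := isSelfAdjoint_negI_smul hX
  have h := B8Ineq170.exp_I_smul_mem_unitary hY
  rwa [hXY] at h

/-- `|e^X| ≤ 1` for skew-adjoint `X`. [folklore] -/
private theorem norm_exp_le_one_of_skew {X : 𝔸} (hX : X ∈ skewAdjoint 𝔸) : ‖exp X‖ ≤ 1 :=
  B8Ineq170.cstar_unitary_norm_le_one (exp_mem_unitary_of_skew hX)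

/-- **(24) of [12]**: `|e^X − 1| ≤ |X|` for skew-adjoint `X` (`X = iA`, `A` hermitian). [cite: Balaban1985Averaging, (24) p.21] -/
theorem norm_exp_sub_one_le_of_skew {X : 𝔸} (hX : X ∈ skewAdjoint 𝔸) : ‖exp X - 1‖ ≤ ‖X‖ := by
  obtain ⟨hY, hXY⟩ := isSelfAdjoint_negI_smul hX
  have h := B8Ineq170.norm_exp_I_smul_sub_one_le hY
  rw [hXY] at h
  refine h.trans_eq ?_
  rw [norm_smul, norm_neg, Complex.norm_I, one_mul]

/-- THE SECOND-ORDER SHARP BOUND: `|e^X − 1 − X| ≤ ½|X|²` for skew-adjoint `X` — the unitary improvement of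
`|e^X − 1 − X| ≤ e^{|X|} − 1 − |X|`, by fencing `s ↦ e^{sX} − 1 − sX` (derivative `(e^{sX} − 1)X`, of norm `≤ s|X|²`
by (24) of [12]) against `s ↦ ½s²|X|²`.  It is the one-factor case of the remainder «O₁((1/2!)η²(∂|A|(p))²)» of
[14] p. 84 (there for `U₁ = e^{iηA}`), and the source of print's `½η²(|ℍ|(∂p))²` in (1.46).
[cite: Balaban1985RegularSpaces, p.84 («a remainder is O₁((1/2!)η²(∂|A|(p))²)»)] -/
theorem norm_exp_sub_one_sub_le_of_skew {X : 𝔸} (hX : X ∈ skewAdjoint 𝔸) :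
    ‖exp X - 1 - X‖ ≤ ‖X‖ ^ 2 / 2 := by
  have hd : ∀ s : ℝ, HasDerivAt (fun u : ℝ => exp (u • X) - 1 - u • X) ((exp (s • X) - 1) * X) s := by
    intro s
    have h1 : HasDerivAt (fun u : ℝ => exp (u • X)) (exp (s • X) * X) s :=
      hasDerivAt_exp_smul_const (𝕂 := ℝ) X s
    have h2 : HasDerivAt (fun u : ℝ => u • X) X s := by
      simpa using (hasDerivAt_id s).smul_const X
    have h3 : HasDerivAt (fun u : ℝ => exp (u • X) - 1 - u • X) (exp (s • X) * X - X) s :=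
      (h1.sub_const (1 : 𝔸)).sub h2
    exact h3.congr_deriv (by rw [sub_mul, one_mul])
  have hcont : ContinuousOn (fun u : ℝ => exp (u • X) - 1 - u • X) (Set.Icc 0 1) :=
    fun s _ => (hd s).continuousAt.continuousWithinAt
  have hder : ∀ s ∈ Set.Ico (0 : ℝ) 1,
      HasDerivWithinAt (fun u : ℝ => exp (u • X) - 1 - u • X) ((exp (s • X) - 1) * X) (Set.Ici s) s :=
    fun s _ => (hd s).hasDerivWithinAt
  have hB : ∀ s : ℝ, HasDerivAt (fun u : ℝ => u ^ 2 / 2 * ‖X‖ ^ 2) (s * ‖X‖ ^ 2) s := by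
    intro s
    have h := ((hasDerivAt_pow 2 s).div_const 2).mul_const (‖X‖ ^ 2)
    refine h.congr_deriv ?_
    simp only [Nat.cast_ofNat, Nat.add_one_sub_one, pow_one]
    ring
  have hbound : ∀ s ∈ Set.Ico (0 : ℝ) 1, ‖(exp (s • X) - 1) * X‖ ≤ s * ‖X‖ ^ 2 := by
    intro s hs
    have h1 : ‖exp (s • X) - 1‖ ≤ s * ‖X‖ := by
      rw [← Complex.coe_smul]
      refine (norm_exp_sub_one_le_of_skew (ofReal_smul_mem_skewAdjoint hX s)).trans_eq ?_
      rw [norm_smul, Complex.norm_real, Real.norm_of_nonneg hs.1]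
    calc ‖(exp (s • X) - 1) * X‖ ≤ ‖exp (s • X) - 1‖ * ‖X‖ := norm_mul_le _ _
      _ ≤ s * ‖X‖ * ‖X‖ := by gcongr
      _ = s * ‖X‖ ^ 2 := by ring
  have h0 : ‖(fun u : ℝ => exp (u • X) - 1 - u • X) 0‖ ≤ (fun u : ℝ => u ^ 2 / 2 * ‖X‖ ^ 2) 0 := by
    simp
  have key := image_norm_le_of_norm_deriv_right_le_deriv_boundary hcont hder h0 hB hbound
    (Set.right_mem_Icc.mpr zero_le_one)
  simp only [one_smul, one_pow] at key
  linarith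

/-- UNITARY SECOND-ORDER DATA ARE MULTIPLICATIVE (first order): `|P₁P₂ − 1| ≤ s₁ + s₂` if `|P₁| ≤ 1`,
`|Pᵢ − 1| ≤ sᵢ` — `P₁P₂ − 1 = P₁(P₂ − 1) + (P₁ − 1)`. [folklore] -/
private theorem norm_mul_sub_one_le_add {P₁ P₂ : 𝔸} {s₁ s₂ : ℝ} (hP₁ : ‖P₁‖ ≤ 1) (h₁ : ‖P₁ - 1‖ ≤ s₁)
    (h₂ : ‖P₂ - 1‖ ≤ s₂) : ‖P₁ * P₂ - 1‖ ≤ s₁ + s₂ := by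
  have hid : P₁ * P₂ - 1 = P₁ * (P₂ - 1) + (P₁ - 1) := by noncomm_ring
  rw [hid]
  have hs₂ : 0 ≤ s₂ := (norm_nonneg _).trans h₂
  calc ‖P₁ * (P₂ - 1) + (P₁ - 1)‖ ≤ ‖P₁ * (P₂ - 1)‖ + ‖P₁ - 1‖ := norm_add_le _ _
    _ ≤ ‖P₁‖ * ‖P₂ - 1‖ + ‖P₁ - 1‖ := by gcongr; exact norm_mul_le _ _
    _ ≤ 1 * s₂ + s₁ := by gcongr
    _ = s₁ + s₂ := by ring

/-- UNITARY SECOND-ORDER DATA ARE MULTIPLICATIVE (second order): `|P₁P₂ − 1 − (L₁ + L₂)| ≤ ½(s₁ + s₂)²` if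
`|Pᵢ − 1| ≤ sᵢ`, `|Pᵢ − 1 − Lᵢ| ≤ ½sᵢ²` — `P₁P₂ − 1 − L₁ − L₂ = (P₁ − 1 − L₁) + (P₂ − 1 − L₂) + (P₁ − 1)(P₂ − 1)`.
[folklore] -/
private theorem norm_mul_sub_one_sub_le {P₁ P₂ L₁ L₂ : 𝔸} {s₁ s₂ : ℝ} (h₁ : ‖P₁ - 1‖ ≤ s₁)
    (h₁' : ‖P₁ - 1 - L₁‖ ≤ s₁ ^ 2 / 2) (h₂ : ‖P₂ - 1‖ ≤ s₂) (h₂' : ‖P₂ - 1 - L₂‖ ≤ s₂ ^ 2 / 2) :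
    ‖P₁ * P₂ - 1 - (L₁ + L₂)‖ ≤ (s₁ + s₂) ^ 2 / 2 := by
  have hid : P₁ * P₂ - 1 - (L₁ + L₂) = (P₁ - 1 - L₁) + (P₂ - 1 - L₂) + (P₁ - 1) * (P₂ - 1) := by
    noncomm_ring
  rw [hid]
  have hs₁ : 0 ≤ s₁ := (norm_nonneg _).trans h₁
  calc ‖(P₁ - 1 - L₁) + (P₂ - 1 - L₂) + (P₁ - 1) * (P₂ - 1)‖
      ≤ ‖P₁ - 1 - L₁‖ + ‖P₂ - 1 - L₂‖ + ‖(P₁ - 1) * (P₂ - 1)‖ := norm_add₃_le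
    _ ≤ s₁ ^ 2 / 2 + s₂ ^ 2 / 2 + ‖P₁ - 1‖ * ‖P₂ - 1‖ := by gcongr; exact norm_mul_le _ _
    _ ≤ s₁ ^ 2 / 2 + s₂ ^ 2 / 2 + s₁ * s₂ := by gcongr
    _ = (s₁ + s₂) ^ 2 / 2 := by ring

variable [Nontrivial 𝔸]

/-- A `U1`-CONJUGATE OF A UNITARY EXPONENTIAL carries the same data: for `u ∈ {|u| ≤ 1, |u⁻¹| ≤ 1}` and
skew-adjoint `Z`, `P = R(u)e^{Z} = e^{R(u)Z}` satisfies `|P| ≤ 1`, `|P − 1| ≤ |Z|`, `|P − 1 − R(u)Z| ≤ ½|Z|²`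
(`R(u)X = uXu⁻¹`; this is how `R(U₀(x,y))` enters `x₂`, `x₃` of (1.49) of [14]). [folklore] -/
private theorem conj_exp_data {u : 𝔸ˣ} (hu : u ∈ U1 𝔸) {Z : 𝔸} (hZ : Z ∈ skewAdjoint 𝔸) :
    ‖exp (conjR u Z)‖ ≤ 1 ∧ ‖exp (conjR u Z) - 1‖ ≤ ‖Z‖ ∧
      ‖exp (conjR u Z) - 1 - conjR u Z‖ ≤ ‖Z‖ ^ 2 / 2 := by
  rw [exp_conjR]
  refine ⟨(norm_conjR_le hu _).trans (norm_exp_le_one_of_skew hZ), ?_, ?_⟩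
  · rw [← conjR_one u, ← conjR_sub, norm_conjR hu]
    exact norm_exp_sub_one_le_of_skew hZ
  · rw [← conjR_one u, ← conjR_sub, ← conjR_sub, norm_conjR hu]
    exact norm_exp_sub_one_sub_le_of_skew hZ

end CStar

/-! ## §2 (1.47) of [14] in the unitary setting: `|(∂_{U₀}e^{B})(p) − 1 − Σᵢxᵢ| ≤ ½(Σ_{b⊂∂p}|B_b|)²` -/

section Plaquette

variable {𝔸 : Type*} [CStarAlgebra 𝔸] [Nontrivial 𝔸]

/-- **The covariant plaquette variable of a unitary perturbation, to second order.**  For `U₀` with values in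
`{|u| ≤ 1, |u⁻¹| ≤ 1}` and a skew-adjoint exponent field `B` (print: `B = iηA`),
`(∂_{U₀}e^{B})(p) = e^{x₁}e^{x₂}e^{x₃}e^{x₄}` ((1.22)/(1.47) of [14]) satisfies `|(∂_{U₀}e^{B})(p) − 1| ≤ Σ_{b⊂∂p}|B_b|`
and `|(∂_{U₀}e^{B})(p) − 1 − Σᵢxᵢ| ≤ ½(Σ_{b⊂∂p}|B_b|)²` — the remainder `O₁((1/2!)(η∂|A|(p))²)` of [14] p. 84 with the
sharp constant. [cite: Balaban1985RegularSpaces, (1.47) p.84] -/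
theorem covPlaqF_taylor_unitary {U₀ : Site d → Fin d → 𝔸ˣ} (h₀ : ∀ y κ, U₀ y κ ∈ U1 𝔸)
    {B : Site d → Fin d → 𝔸} (hB : ∀ y κ, B y κ ∈ skewAdjoint 𝔸) (μ ν : Fin d) (x : Site d) :
    ‖covPlaqF U₀ (expCfg B) μ ν x - 1‖ ≤ bdry B μ ν x ∧
      ‖covPlaqF U₀ (expCfg B) μ ν x - 1 - lin U₀ B μ ν x‖ ≤ (bdry B μ ν x) ^ 2 / 2 := by
  -- the four unitary factors and their data
  have d1 : ‖exp (X1 B μ x)‖ ≤ 1 ∧ ‖exp (X1 B μ x) - 1‖ ≤ ‖B x μ‖ ∧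
      ‖exp (X1 B μ x) - 1 - X1 B μ x‖ ≤ ‖B x μ‖ ^ 2 / 2 :=
    ⟨norm_exp_le_one_of_skew (hB x μ), norm_exp_sub_one_le_of_skew (hB x μ),
      norm_exp_sub_one_sub_le_of_skew (hB x μ)⟩
  have d2 : ‖exp (X2 U₀ B μ ν x)‖ ≤ 1 ∧ ‖exp (X2 U₀ B μ ν x) - 1‖ ≤ ‖B (x + e μ) ν‖ ∧
      ‖exp (X2 U₀ B μ ν x) - 1 - X2 U₀ B μ ν x‖ ≤ ‖B (x + e μ) ν‖ ^ 2 / 2 :=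
    conj_exp_data (h₀ x μ) (hB (x + e μ) ν)
  have d3 : ‖exp (X3 U₀ B μ ν x)‖ ≤ 1 ∧ ‖exp (X3 U₀ B μ ν x) - 1‖ ≤ ‖B (x + e ν) μ‖ ∧
      ‖exp (X3 U₀ B μ ν x) - 1 - X3 U₀ B μ ν x‖ ≤ ‖B (x + e ν) μ‖ ^ 2 / 2 := by
    have h := conj_exp_data (h₀ x ν) ((skewAdjoint 𝔸).neg_mem (hB (x + e ν) μ))
    rw [norm_neg] at h
    exact h
  have d4 : ‖exp (X4 B ν x)‖ ≤ 1 ∧ ‖exp (X4 B ν x) - 1‖ ≤ ‖B x ν‖ ∧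
      ‖exp (X4 B ν x) - 1 - X4 B ν x‖ ≤ ‖B x ν‖ ^ 2 / 2 := by
    have hneg := (skewAdjoint 𝔸).neg_mem (hB x ν)
    refine ⟨norm_exp_le_one_of_skew hneg, ?_, ?_⟩
    · exact (norm_exp_sub_one_le_of_skew hneg).trans_eq (norm_neg _)
    · exact (norm_exp_sub_one_sub_le_of_skew hneg).trans_eq (by rw [norm_neg])
  -- the two pairs
  have p12 : ‖exp (X1 B μ x) * exp (X2 U₀ B μ ν x) - 1‖ ≤ ‖B x μ‖ + ‖B (x + e μ) ν‖ :=
    norm_mul_sub_one_le_add d1.1 d1.2.1 d2.2.1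
  have p12' : ‖exp (X1 B μ x) * exp (X2 U₀ B μ ν x) - 1 - (X1 B μ x + X2 U₀ B μ ν x)‖
      ≤ (‖B x μ‖ + ‖B (x + e μ) ν‖) ^ 2 / 2 :=
    norm_mul_sub_one_sub_le d1.2.1 d1.2.2 d2.2.1 d2.2.2
  have n12 : ‖exp (X1 B μ x) * exp (X2 U₀ B μ ν x)‖ ≤ 1 :=
    (norm_mul_le _ _).trans (mul_le_one₀ d1.1 (norm_nonneg _) d2.1)
  have p34 : ‖exp (X3 U₀ B μ ν x) * exp (X4 B ν x) - 1‖ ≤ ‖B (x + e ν) μ‖ + ‖B x ν‖ :=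
    norm_mul_sub_one_le_add d3.1 d3.2.1 d4.2.1
  have p34' : ‖exp (X3 U₀ B μ ν x) * exp (X4 B ν x) - 1 - (X3 U₀ B μ ν x + X4 B ν x)‖
      ≤ (‖B (x + e ν) μ‖ + ‖B x ν‖) ^ 2 / 2 :=
    norm_mul_sub_one_sub_le d3.2.1 d3.2.2 d4.2.1 d4.2.2
  rw [covPlaqF_expCfg]
  refine ⟨?_, ?_⟩
  · refine (norm_mul_sub_one_le_add n12 p12 p34).trans_eq ?_
    simp only [bdry]
    ring
  · have h := norm_mul_sub_one_sub_le p12 p12' p34 p34'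
    have hlin : X1 B μ x + X2 U₀ B μ ν x + (X3 U₀ B μ ν x + X4 B ν x) = lin U₀ B μ ν x := by
      simp only [lin]
      abel
    rw [hlin] at h
    refine h.trans_eq ?_
    simp only [bdry]
    ring

end Plaquette

/-! ## §3 The mechanism: `|(e^{B}U₀)^{g}(∂p) − 1| ≤ |U₀(∂p) − 1| + |Σᵢxᵢ| + ½(Σ_{b⊂∂p}|B_b|)²` -/

section Mechanism

variable {𝔸 : Type*} [CStarAlgebra 𝔸] [Nontrivial 𝔸]

/-- A unitary of `𝔸`, as a unit, lies in `{|u| ≤ 1, |u⁻¹| ≤ 1}`. [cite: Balaban1985Averaging, (19) p.21] -/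
theorem mem_U1_of_mem_unitary {u : 𝔸ˣ} (hu : (u : 𝔸) ∈ unitary 𝔸) : u ∈ U1 𝔸 :=
  B7Prop2Explicit.unitaryUnits_le_U1 (B7Prop2Explicit.mem_unitaryUnits.mpr hu)

/-- `e^{B}` is `U1`-valued bondwise for a skew-adjoint exponent field. [cite: Balaban1985RegularSpaces, (1.41) p.83] -/
theorem expCfg_mem_U1 {B : Site d → Fin d → 𝔸} (hB : ∀ y κ, B y κ ∈ skewAdjoint 𝔸) (y : Site d) (κ : Fin d) :
    expCfg B y κ ∈ U1 𝔸 :=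
  mem_U1_of_mem_unitary (by
    show exp (B y κ) ∈ unitary 𝔸
    exact exp_mem_unitary_of_skew (hB y κ))

omit [Nontrivial 𝔸] in
/-- The free-ring identity behind the mechanism: `aPc − 1 = a(P − 1)c + (ac − 1)`. [folklore] -/
private theorem ring_identity_aPc (a P c : 𝔸) : a * P * c - 1 = a * (P - 1) * c + (a * c - 1) := by
  noncomm_ring

/-- **THE MECHANISM OF (1.46), general exponent field.**  For `U₀` with values in `{|u| ≤ 1, |u⁻¹| ≤ 1}` and a
skew-adjoint exponent field `B`, the plaquette variables of `e^{B}U₀` satisfy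
`|(e^{B}U₀)(∂p) − 1| ≤ |U₀(∂p) − 1| + |Σᵢxᵢ| + ½(Σ_{b⊂∂p}|B_b|)²` (`Σᵢxᵢ = lin`, `= iη²(D^η_{U₀}A)(p)` at `B = iηA`),
by (1.21) of [14] `(e^{B}U₀)(∂p) = a·U₀(∂p)·c`, `|a|, |c| ≤ 1`, `ac = (∂_{U₀}e^{B})(p)` and §2.
[cite: Balaban1989LargeFieldI, (1.46) p.186] -/
theorem mechanism {U₀ : Site d → Fin d → 𝔸ˣ} (h₀ : ∀ y κ, U₀ y κ ∈ U1 𝔸) {B : Site d → Fin d → 𝔸}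
    (hB : ∀ y κ, B y κ ∈ skewAdjoint 𝔸) (μ ν : Fin d) (x : Site d) :
    ‖plaqF (mulCfg (expCfg B) U₀) μ ν x - 1‖
      ≤ ‖plaqF U₀ μ ν x - 1‖ + ‖lin U₀ B μ ν x‖ + (bdry B μ ν x) ^ 2 / 2 := by
  have hU' : ∀ y κ, expCfg B y κ ∈ U1 𝔸 := expCfg_mem_U1 hB
  set a : 𝔸 := ((lead U₀ (expCfg B) μ ν x : 𝔸ˣ) : 𝔸) with ha
  set c : 𝔸 := ((trail U₀ (expCfg B) μ ν x : 𝔸ˣ) : 𝔸) with hc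
  set P : 𝔸 := plaqF U₀ μ ν x with hP
  have hna : ‖a‖ ≤ 1 := (mem_U1.mp (lead_mem h₀ hU' μ ν x)).1
  have hnc : ‖c‖ ≤ 1 := (mem_U1.mp (trail_mem h₀ hU' μ ν x)).1
  have hac : a * c = covPlaqF U₀ (expCfg B) μ ν x := by
    simp only [ha, hc, covPlaqF, covPlaq, Units.val_mul]
  have h121 : plaqF (mulCfg (expCfg B) U₀) μ ν x = a * P * c := eq121 U₀ (expCfg B) μ ν x
  obtain ⟨_, h2⟩ := covPlaqF_taylor_unitary h₀ hB μ ν x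
  rw [h121, ring_identity_aPc, hac]
  have hsplit : covPlaqF U₀ (expCfg B) μ ν x - 1
      = lin U₀ B μ ν x + (covPlaqF U₀ (expCfg B) μ ν x - 1 - lin U₀ B μ ν x) := by abel
  calc ‖a * (P - 1) * c + (covPlaqF U₀ (expCfg B) μ ν x - 1)‖
      ≤ ‖a * (P - 1) * c‖ + ‖covPlaqF U₀ (expCfg B) μ ν x - 1‖ := norm_add_le _ _
    _ ≤ ‖a‖ * ‖P - 1‖ * ‖c‖ + (‖lin U₀ B μ ν x‖ + ‖covPlaqF U₀ (expCfg B) μ ν x - 1 - lin U₀ B μ ν x‖) := by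
        gcongr
        · exact norm_mul₃_le
        · rw [hsplit]
          exact (norm_add_le _ _).trans_eq (by rw [← hsplit])
    _ ≤ 1 * ‖P - 1‖ * 1 + (‖lin U₀ B μ ν x‖ + (bdry B μ ν x) ^ 2 / 2) := by
        gcongr
    _ = ‖P - 1‖ + ‖lin U₀ B μ ν x‖ + (bdry B μ ν x) ^ 2 / 2 := by ring

/-- A gauge transformation with values in `{|u| ≤ 1, |u⁻¹| ≤ 1}` does not change `|U(∂p) − 1|`
(`U^{g}(∂p) = R(g(x))U(∂p)`, (8) of [12]) — the exponent `u⁻¹` of (1.44). [cite: Balaban1985Averaging, (8) p.18] -/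
theorem norm_plaqF_gaugeAct_sub_one {g : Site d → 𝔸ˣ} (hg : ∀ y, g y ∈ U1 𝔸) (V : Site d → Fin d → 𝔸ˣ)
    (μ ν : Fin d) (x : Site d) : ‖plaqF (gaugeAct g V) μ ν x - 1‖ = ‖plaqF V μ ν x - 1‖ := by
  rw [plaqF_gaugeAct, ← conjR_one (g x), ← conjR_sub, norm_conjR (hg x), conjR_one]

omit [Nontrivial 𝔸] in
/-- `|Σᵢxᵢ(iηH)| = η²|(D^η_{U₀}H)(p)|` — print's term `η²|(D^η_{U^{(n+1)}}ℍ)(p)|`. [cite: Balaban1989LargeFieldI, (1.46) p.186] -/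
theorem norm_lin_iEta {η : ℝ} (hη : η ≠ 0) (U₀ : Site d → Fin d → 𝔸ˣ) (H : Site d → Fin d → 𝔸) (μ ν : Fin d)
    (x : Site d) : ‖lin U₀ (iEta η H) μ ν x‖ = η ^ 2 * ‖plaqCovDeriv η U₀ H μ ν x‖ := by
  rw [lin_printed hη, B8Eq155JBound.norm_I_eta_sq_smul]

/-- **THE MECHANISM OF (1.46) in print's letters.**  `U = (e^{iηH}U₀)^{g}` with `U₀` (print: `U^{(n+1)}_{k,Z}`), `g`
(print: `u⁻¹`) valued in `{|u| ≤ 1, |u⁻¹| ≤ 1}` (e.g. unitary), `H` (print: `ℍ^{(n)}_{k,Z}(…)`) hermitian, `η > 0`: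
`|U(∂p) − 1| ≤ |U₀(∂p) − 1| + η²|(D^η_{U₀}H)(p)| + ½η²(Σ_{b⊂∂p}|H(b)|)²`. [cite: Balaban1989LargeFieldI, (1.44)–(1.46) p.186] -/
theorem mechanism_iEta {η : ℝ} (hη : 0 < η) {U₀ : Site d → Fin d → 𝔸ˣ} (h₀ : ∀ y κ, U₀ y κ ∈ U1 𝔸)
    {H : Site d → Fin d → 𝔸} (hH : ∀ y κ, IsSelfAdjoint (H y κ)) {g : Site d → 𝔸ˣ} (hg : ∀ y, g y ∈ U1 𝔸)
    (μ ν : Fin d) (x : Site d) :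
    ‖plaqF (gaugeAct g (mulCfg (expCfg (iEta η H)) U₀)) μ ν x - 1‖
      ≤ ‖plaqF U₀ μ ν x - 1‖ + η ^ 2 * ‖plaqCovDeriv η U₀ H μ ν x‖
        + (η * (‖H x μ‖ + ‖H (x + e μ) ν‖ + ‖H (x + e ν) μ‖ + ‖H x ν‖)) ^ 2 / 2 := by
  have hB : ∀ y κ, iEta η H y κ ∈ skewAdjoint 𝔸 := fun y κ => I_eta_smul_mem_skewAdjoint η (hH y κ)
  rw [norm_plaqF_gaugeAct_sub_one hg, ← bdry_iEta hη.le, ← norm_lin_iEta hη.ne']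
  exact mechanism h₀ hB μ ν x

/-- **(1.46), FIRST PRINTED INEQUALITY** (p. 186): with `|ℍ|(∂p) := Σ_{b⊂∂p}|H(b)|`,
`|U(∂p) − 1| ≦ |U₀(∂p) − 1|(1 + ½η|ℍ|(∂p)) + η²|(D^η_{U₀}ℍ)(p)| + ½η²(|ℍ|(∂p))²` for `U = (e^{iηℍ}U₀)^{g}` as in (1.44)
(from `mechanism_iEta`; the printed cross term `|U₀(∂p) − 1|·½η|ℍ|(∂p)` is nonnegative slack).
[cite: Balaban1989LargeFieldI, (1.46) p.186] -/
theorem ineq146_first {η : ℝ} (hη : 0 < η) {U₀ : Site d → Fin d → 𝔸ˣ} (h₀ : ∀ y κ, U₀ y κ ∈ U1 𝔸)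
    {H : Site d → Fin d → 𝔸} (hH : ∀ y κ, IsSelfAdjoint (H y κ)) {g : Site d → 𝔸ˣ} (hg : ∀ y, g y ∈ U1 𝔸)
    (μ ν : Fin d) (x : Site d) :
    ‖plaqF (gaugeAct g (mulCfg (expCfg (iEta η H)) U₀)) μ ν x - 1‖
      ≤ ‖plaqF U₀ μ ν x - 1‖ * (1 + 1 / 2 * η * (‖H x μ‖ + ‖H (x + e μ) ν‖ + ‖H (x + e ν) μ‖ + ‖H x ν‖))
        + η ^ 2 * ‖plaqCovDeriv η U₀ H μ ν x‖
        + 1 / 2 * η ^ 2 * (‖H x μ‖ + ‖H (x + e μ) ν‖ + ‖H (x + e ν) μ‖ + ‖H x ν‖) ^ 2 := by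
  have h := mechanism_iEta hη h₀ hH hg μ ν x
  have hS : 0 ≤ ‖H x μ‖ + ‖H (x + e μ) ν‖ + ‖H (x + e ν) μ‖ + ‖H x ν‖ := by positivity
  have hslack : 0 ≤ ‖plaqF U₀ μ ν x - 1‖ * (1 / 2 * η * (‖H x μ‖ + ‖H (x + e μ) ν‖ + ‖H (x + e ν) μ‖ + ‖H x ν‖)) :=
    mul_nonneg (norm_nonneg _) (by positivity)
  nlinarith [h, hslack]

end Mechanism

/-! ## §4 (1.45) ⇒ the second printed inequality of (1.46): r12's leaf `Ineq146` for the lattice plaquette variables -/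

section Second

variable {𝔸 : Type*} [CStarAlgebra 𝔸] [Nontrivial 𝔸]

omit [Nontrivial 𝔸] in
/-- `|(D^η_{U₀}H)(p_{μν}(x))| ≤ |(∇^η_{U₀,μ}H_ν)(x)| + |(∇^η_{U₀,ν}H_μ)(x)|` ((3.4) of [Balaban1985BackgroundPropagators]:
`(D^η_{U₀}A)(p_{μν}(x)) = (D^η_{U₀,μ}A_ν)(x) − (D^η_{U₀,ν}A_μ)(x)`). [cite: Balaban1985BackgroundPropagators, (3.4) p.391] -/
theorem norm_plaqCovDeriv_le (η : ℝ) (U₀ : Site d → Fin d → 𝔸ˣ) (H : Site d → Fin d → 𝔸) (μ ν : Fin d)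
    (x : Site d) : ‖plaqCovDeriv η U₀ H μ ν x‖
      ≤ ‖covDerivFwd η U₀ μ (fun y => H y ν) x‖ + ‖covDerivFwd η U₀ ν (fun y => H y μ) x‖ := by
  rw [plaqCovDeriv_eq_covDerivFwd]
  exact norm_sub_le _ _

/-- THE ARITHMETIC OF THE SECOND STEP: with `X = B₃e^{−δd}4δ′_j`, `T₂ ≤ 2L^{−2i}X`, `T₃ ≤ 8L^{−2i}X²` and `4X ≤ 1/8`
give `T₂ + T₃ ≤ 9B₃e^{−δd}δ′_jL^{−2i}` (print's `9` absorbing the quadratic term). [cite: Balaban1989LargeFieldI, (1.46) p.186] -/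
theorem second_step_arith {T₂ T₃ X Linv E B₃ δ'j : ℝ} (hX : X = B₃ * E * (4 * δ'j)) (hX0 : 0 ≤ X)
    (hX8 : 4 * X ≤ 1 / 8) (h₂ : T₂ ≤ 2 * Linv ^ 2 * X) (h₃ : T₃ ≤ 8 * Linv ^ 2 * X ^ 2) :
    T₂ + T₃ ≤ 9 * B₃ * E * δ'j * Linv ^ 2 := by
  have hL : 0 ≤ Linv ^ 2 := sq_nonneg _
  have h4 : 8 * Linv ^ 2 * X ^ 2 ≤ 2 * Linv ^ 2 * X * (1 / 8) := by
    have : 8 * Linv ^ 2 * X ^ 2 = 2 * Linv ^ 2 * X * (4 * X) := by ring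
    rw [this]
    exact mul_le_mul_of_nonneg_left hX8 (by positivity)
  calc T₂ + T₃ ≤ 2 * Linv ^ 2 * X + 2 * Linv ^ 2 * X * (1 / 8) := by linarith
    _ = 9 / 4 * X * Linv ^ 2 := by ring
    _ = 9 * B₃ * E * δ'j * Linv ^ 2 := by rw [hX]; ring

/-- **(1.45) ⇒ (1.46), SECOND PRINTED INEQUALITY** — r12's typed leaf `B15.PrelimIntegrations.Ineq146` DISCHARGED for
the lattice plaquette variables.  Data: `U₀ = U^{(n+1)}_{k,Z}`, `g = u⁻¹` valued in `{|u| ≤ 1, |u⁻¹| ≤ 1}`, `H = ℍ^{(n)}_{k,Z}(…)`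
hermitian, `η > 0`, `U = (e^{iηH}U₀)^{g}` ((1.44)); `p = p_{μν}(x) ∈ B^i(y)`; (1.45) `Ineq145 sH sDH B₃ δ d δ′_j` with
its two sups instantiated at the four bonds of `∂p` (`L^iη|H(b)| ≤ sH`) and at the two covariant derivatives at `x`
(`(L^iη)²|(∇^η_{U₀,μ}H_ν)(x)|, (L^iη)²|(∇^η_{U₀,ν}H_μ)(x)| ≤ sDH`); `L^i·L^{−i} = 1`, `L^{−i} ≥ 0`; signs `B₃, δ′_j ≥ 0`,
`δd ≥ 0`; the located smallness `128B₃δ′_j ≤ 1`; p. 183 `δ′_j = (A₁p₁(g_j))/(A₀p₀(g_j))·ε_j` (as `≤`, `ratio ≥ 0`);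
the flow factor `ε_j ≤ (1+β₀)(1+(j−i)^{1/2})ε_i` ([III] (2.8), `flowFactor_of_flowIneq28`).  Conclusion:
`|U(∂p) − 1| ≤ |U₀(∂p) − 1|(1 + 8B₃L^{−i}e^{−δd}δ′_j) + 9B₃(A₁p₁(g_j))/(A₀p₀(g_j))(1+β₀)(1+(j−i)^{1/2})e^{−δd}·ε_iL^{−2i}`,
i.e. `Ineq146` with `εE = ε_iL^{−2i} = ε_i(L^{k−i}η)²` (`units_εE`). [cite: Balaban1989LargeFieldI, (1.45)–(1.46) p.186] -/
theorem ineq146_of_145 {η : ℝ} (hη : 0 < η) {U₀ : Site d → Fin d → 𝔸ˣ} (h₀ : ∀ y κ, U₀ y κ ∈ U1 𝔸)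
    {H : Site d → Fin d → 𝔸} (hH : ∀ y κ, IsSelfAdjoint (H y κ)) {g : Site d → 𝔸ˣ} (hg : ∀ y, g y ∈ U1 𝔸)
    (μ ν : Fin d) (x : Site d)
    {sH sDH B₃ δ dist δ'j ratio β₀ gap εi εj Linv Lpow : ℝ}
    (h145 : Ineq145 sH sDH B₃ δ dist δ'j)
    (hH₁ : Lpow * η * ‖H x μ‖ ≤ sH) (hH₂ : Lpow * η * ‖H (x + e μ) ν‖ ≤ sH)
    (hH₃ : Lpow * η * ‖H (x + e ν) μ‖ ≤ sH) (hH₄ : Lpow * η * ‖H x ν‖ ≤ sH)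
    (hDH₁ : (Lpow * η) ^ 2 * ‖covDerivFwd η U₀ μ (fun y => H y ν) x‖ ≤ sDH)
    (hDH₂ : (Lpow * η) ^ 2 * ‖covDerivFwd η U₀ ν (fun y => H y μ) x‖ ≤ sDH)
    (hL : Lpow * Linv = 1) (hLinv : 0 ≤ Linv)
    (hB₃ : 0 ≤ B₃) (hδ'j : 0 ≤ δ'j) (hdist : 0 ≤ δ * dist) (hsmall : 128 * B₃ * δ'j ≤ 1)
    (hratio : 0 ≤ ratio) (hδ'ε : δ'j ≤ ratio * εj)
    (hflow : εj ≤ (1 + β₀) * (1 + gap ^ (1 / 2 : ℝ)) * εi) :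
    Ineq146 ‖plaqF (gaugeAct g (mulCfg (expCfg (iEta η H)) U₀)) μ ν x - 1‖ ‖plaqF U₀ μ ν x - 1‖
      B₃ Linv δ dist δ'j ratio β₀ gap (εi * Linv ^ 2) := by
  unfold Ineq146
  set E : ℝ := Real.exp (-(δ * dist)) with hE
  set X : ℝ := B₃ * E * (4 * δ'j) with hX
  set dev₀ : ℝ := ‖plaqF U₀ μ ν x - 1‖ with hdev₀
  have hE0 : 0 < E := Real.exp_pos _
  have hE1 : E ≤ 1 := by
    rw [hE]
    exact Real.exp_le_one_iff.mpr (by linarith)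
  have hX0 : 0 ≤ X := by rw [hX]; positivity
  have hX8 : 4 * X ≤ 1 / 8 := by
    have h1 : B₃ * E * δ'j ≤ B₃ * 1 * δ'j :=
      mul_le_mul_of_nonneg_right (mul_le_mul_of_nonneg_left hE1 hB₃) hδ'j
    rw [hX]
    nlinarith
  obtain ⟨hsH, hsDH⟩ := h145
  -- the unit conversions `η·q = L^{−i}·(L^iη·q)`, `η²·q = L^{−2i}·((L^iη)²·q)`
  have hconv1 : ∀ q : ℝ, η * q = Linv * (Lpow * η * q) := fun q => by
    calc η * q = (Lpow * Linv) * (η * q) := by rw [hL, one_mul]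
      _ = Linv * (Lpow * η * q) := by ring
  have hconv2 : ∀ q : ℝ, η ^ 2 * q = Linv ^ 2 * ((Lpow * η) ^ 2 * q) := fun q => by
    calc η ^ 2 * q = (Lpow * Linv) ^ 2 * (η ^ 2 * q) := by rw [hL, one_pow, one_mul]
      _ = Linv ^ 2 * ((Lpow * η) ^ 2 * q) := by ring
  -- the bonds: `η|H(b)| ≤ L^{−i}X`
  have hb : ∀ q : ℝ, Lpow * η * q ≤ sH → η * q ≤ Linv * X := fun q hq => by
    rw [hconv1 q]
    exact mul_le_mul_of_nonneg_left (hq.trans hsH) hLinv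
  have hS : η * (‖H x μ‖ + ‖H (x + e μ) ν‖ + ‖H (x + e ν) μ‖ + ‖H x ν‖) ≤ 4 * (Linv * X) := by
    have := hb _ hH₁; have := hb _ hH₂; have := hb _ hH₃; have := hb _ hH₄
    linarith
  have hS0 : 0 ≤ η * (‖H x μ‖ + ‖H (x + e μ) ν‖ + ‖H (x + e ν) μ‖ + ‖H x ν‖) := by positivity
  -- T₂ = η²|(DH)(p)| ≤ 2L^{−2i}X
  have hT₂ : η ^ 2 * ‖plaqCovDeriv η U₀ H μ ν x‖ ≤ 2 * Linv ^ 2 * X := by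
    have h1 : η ^ 2 * ‖covDerivFwd η U₀ μ (fun y => H y ν) x‖ ≤ Linv ^ 2 * X := by
      rw [hconv2]
      exact mul_le_mul_of_nonneg_left (hDH₁.trans hsDH) (sq_nonneg _)
    have h2 : η ^ 2 * ‖covDerivFwd η U₀ ν (fun y => H y μ) x‖ ≤ Linv ^ 2 * X := by
      rw [hconv2]
      exact mul_le_mul_of_nonneg_left (hDH₂.trans hsDH) (sq_nonneg _)
    have h3 := mul_le_mul_of_nonneg_left (norm_plaqCovDeriv_le η U₀ H μ ν x) (sq_nonneg η)
    rw [mul_add] at h3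
    linarith
  -- T₃ = ½η²(Σ|H|)² ≤ 8L^{−2i}X²
  have hT₃ : (η * (‖H x μ‖ + ‖H (x + e μ) ν‖ + ‖H (x + e ν) μ‖ + ‖H x ν‖)) ^ 2 / 2 ≤ 8 * Linv ^ 2 * X ^ 2 := by
    have h1 : (η * (‖H x μ‖ + ‖H (x + e μ) ν‖ + ‖H (x + e ν) μ‖ + ‖H x ν‖)) ^ 2 ≤ (4 * (Linv * X)) ^ 2 :=
      pow_le_pow_left₀ hS0 hS 2
    nlinarith
  have hmech := mechanism_iEta hη h₀ hH hg μ ν x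
  have h23 := second_step_arith hX hX0 hX8 hT₂ hT₃
  -- δ′_j ≤ ratio·(1+β₀)(1+gap^{1/2})·ε_i
  have hδ'' : δ'j ≤ ratio * ((1 + β₀) * (1 + gap ^ (1 / 2 : ℝ)) * εi) :=
    hδ'ε.trans (mul_le_mul_of_nonneg_left hflow hratio)
  have hcoef : 0 ≤ 9 * B₃ * E * Linv ^ 2 := by positivity
  have hlast : 9 * B₃ * E * δ'j * Linv ^ 2
      ≤ 9 * B₃ * ratio * (1 + β₀) * (1 + gap ^ (1 / 2 : ℝ)) * E * (εi * Linv ^ 2) := by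
    have := mul_le_mul_of_nonneg_left hδ'' hcoef
    calc 9 * B₃ * E * δ'j * Linv ^ 2 = 9 * B₃ * E * Linv ^ 2 * δ'j := by ring
      _ ≤ 9 * B₃ * E * Linv ^ 2 * (ratio * ((1 + β₀) * (1 + gap ^ (1 / 2 : ℝ)) * εi)) := this
      _ = 9 * B₃ * ratio * (1 + β₀) * (1 + gap ^ (1 / 2 : ℝ)) * E * (εi * Linv ^ 2) := by ring
  have hfirst : dev₀ ≤ dev₀ * (1 + 8 * B₃ * Linv * E * δ'j) := by
    have : 0 ≤ dev₀ * (8 * B₃ * Linv * E * δ'j) := mul_nonneg (norm_nonneg _) (by positivity)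
    linarith
  linarith [hmech, h23, hlast, hfirst]

/-- THE FLOW FACTOR FROM [III] (2.8): along a coupling sequence `g` with `FlowIneq28 ε g β′ β₀ K` (tree `B14`),
for `i ≤ j ≤ K`, `β₀ ≥ 0`, `ε_i ≥ 0`: `ε_j ≤ (1+β₀)(1+(j−i)^{1/2})ε_i` — (2.8) `ε_j ≤ (1+β₀)(j−i)^{1/2}ε_i` for `i < j`,
and `ε_j = ε_i` for `i = j` (print's case "i = j" of (1.46)). [cite: Balaban1988Convergent, (2.8) p.256] -/
theorem flowFactor_of_flowIneq28 {ε g : ℕ → ℝ} {β' β₀ : ℝ} {K : ℕ} (h28 : B14.FlowIneq28 ε g β' β₀ K)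
    (hβ₀ : 0 ≤ β₀) {i j : ℕ} (hij : i ≤ j) (hjK : j ≤ K) (hεi : 0 ≤ ε i) :
    ε j ≤ (1 + β₀) * (1 + (((j : ℝ) - i)) ^ (1 / 2 : ℝ)) * ε i := by
  rcases hij.eq_or_lt with h | h
  · subst h
    have h0 : ((i : ℝ) - i) ^ (1 / 2 : ℝ) = 0 := by
      rw [sub_self, Real.zero_rpow (by norm_num)]
    rw [h0, add_zero, mul_one]
    nlinarith
  · have h1 := (h28 i j h hjK).1
    have hsqrt : Real.sqrt ((j : ℝ) - i) = ((j : ℝ) - i) ^ (1 / 2 : ℝ) := Real.sqrt_eq_rpow _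
    rw [hsqrt] at h1
    have hr : 0 ≤ ((j : ℝ) - i) ^ (1 / 2 : ℝ) := Real.rpow_nonneg (by
      have : (i : ℝ) < j := by exact_mod_cast h
      linarith) _
    calc ε j ≤ (1 + β₀) * ((j : ℝ) - i) ^ (1 / 2 : ℝ) * ε i := h1
      _ ≤ (1 + β₀) * (1 + ((j : ℝ) - i) ^ (1 / 2 : ℝ)) * ε i := by
          have : 0 ≤ (1 + β₀) * ε i := by positivity
          nlinarith

/-- Units: `ε_i·L^{−2i} = ε_i(L^{k−i}η)²` for `η = L^{−k}`, `i ≤ k`, `L ≥ 1` — print's last factor `ε_i(L^{k−i}η)²`.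
[cite: Balaban1989LargeFieldI, (1.46) p.186] -/
theorem units_εE {L : ℕ} (hL : 1 ≤ L) {i k : ℕ} (hik : i ≤ k) (εi : ℝ) :
    εi * (((L : ℝ) ^ i)⁻¹) ^ 2 = εi * ((L : ℝ) ^ (k - i) * ((L : ℝ) ^ k)⁻¹) ^ 2 := by
  have hL0 : (L : ℝ) ≠ 0 := Nat.cast_ne_zero.mpr (by omega)
  congr 1
  have h : (L : ℝ) ^ (k - i) * ((L : ℝ) ^ k)⁻¹ = ((L : ℝ) ^ i)⁻¹ := by
    have hk : (L : ℝ) ^ k = (L : ℝ) ^ (k - i) * (L : ℝ) ^ i := by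
      rw [← pow_add, Nat.sub_add_cancel hik]
    rw [hk, mul_inv, ← mul_assoc, mul_inv_cancel₀ (pow_ne_zero _ hL0), one_mul]
  rw [h]

/-- **(1.46) ALONG THE [III] FLOW** — `ineq146_of_145` with the flow factor supplied by `B14.FlowIneq28` (scales
`i ≤ j ≤ K`), `δ′_j ≤ ratio·ε_j`, and the conclusion in print's units `εE = ε_i(L^{k−i}η)²`, `η = L^{−k}`,
`L^{−i} = (L^i)⁻¹`. [cite: Balaban1989LargeFieldI, (1.46) p.186] -/
theorem ineq146_holds_lattice {L : ℕ} (hL : 1 ≤ L) {i j k K : ℕ} (hij : i ≤ j) (hjK : j ≤ K) (hik : i ≤ k)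
    {η : ℝ} (hη : η = ((L : ℝ) ^ k)⁻¹) {U₀ : Site d → Fin d → 𝔸ˣ} (h₀ : ∀ y κ, U₀ y κ ∈ U1 𝔸)
    {H : Site d → Fin d → 𝔸} (hH : ∀ y κ, IsSelfAdjoint (H y κ)) {g : Site d → 𝔸ˣ} (hg : ∀ y, g y ∈ U1 𝔸)
    (μ ν : Fin d) (x : Site d)
    {sH sDH B₃ δ dist δ'j ratio β' β₀ : ℝ} {ε gc : ℕ → ℝ}
    (h145 : Ineq145 sH sDH B₃ δ dist δ'j)
    (hH₁ : (L : ℝ) ^ i * η * ‖H x μ‖ ≤ sH) (hH₂ : (L : ℝ) ^ i * η * ‖H (x + e μ) ν‖ ≤ sH)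
    (hH₃ : (L : ℝ) ^ i * η * ‖H (x + e ν) μ‖ ≤ sH) (hH₄ : (L : ℝ) ^ i * η * ‖H x ν‖ ≤ sH)
    (hDH₁ : ((L : ℝ) ^ i * η) ^ 2 * ‖covDerivFwd η U₀ μ (fun y => H y ν) x‖ ≤ sDH)
    (hDH₂ : ((L : ℝ) ^ i * η) ^ 2 * ‖covDerivFwd η U₀ ν (fun y => H y μ) x‖ ≤ sDH)
    (hB₃ : 0 ≤ B₃) (hδ'j : 0 ≤ δ'j) (hdist : 0 ≤ δ * dist) (hsmall : 128 * B₃ * δ'j ≤ 1)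
    (hratio : 0 ≤ ratio) (hδ'ε : δ'j ≤ ratio * ε j)
    (h28 : B14.FlowIneq28 ε gc β' β₀ K) (hβ₀ : 0 ≤ β₀) (hεi : 0 ≤ ε i) :
    Ineq146 ‖plaqF (gaugeAct g (mulCfg (expCfg (iEta η H)) U₀)) μ ν x - 1‖ ‖plaqF U₀ μ ν x - 1‖
      B₃ (((L : ℝ) ^ i)⁻¹) δ dist δ'j ratio β₀ ((j : ℝ) - i)
      (ε i * ((L : ℝ) ^ (k - i) * η) ^ 2) := by
  have hL0 : (0 : ℝ) < L := Nat.cast_pos.mpr (by omega)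
  have hLpos : (0 : ℝ) < (L : ℝ) ^ i := pow_pos hL0 i
  have hηpos : 0 < η := by rw [hη]; exact inv_pos.mpr (pow_pos hL0 k)
  have hflow := flowFactor_of_flowIneq28 h28 hβ₀ hij hjK hεi
  have h := ineq146_of_145 hηpos h₀ hH hg μ ν x h145 hH₁ hH₂ hH₃ hH₄ hDH₁ hDH₂
    (mul_inv_cancel₀ hLpos.ne') (inv_nonneg.mpr hLpos.le) hB₃ hδ'j hdist hsmall hratio hδ'ε hflow
  rw [units_εE hL hik, ← hη] at h
  exact h

end Second

end Literature.MathematicalPhysics.QuantumFieldTheory.Balaban1983to89.B15Ineq146Proof
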